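import Literature.IUT.LogVolume.TensorPacketHullContainers
import Literature.IUT.LogVolume.LogVolumeEstimates
import Literature.IUT.LogVolume.TensorPacketLemmas
import Literature.IUT.LogVolume.TensorPacketSlotTwists
import HarnessLib

/-!
# The (Ind1)-slot-union form of [IUTchIV] Thm. 1.10 Steps (v)–(vi) on the tensor packet `V = ⊗_{ℚ_p} k_i`:
# container, holomorphic hull and log-volume of the possible images coming from EVERY slot (`λ_min` form)

Mochizuki, *Inter-universal Teichmüller theory IV* (RIMS ms Apr. 2020 = PRIMS **57** (2021)), proof of
Thm. 1.10, Step (v), p. 27–28: "· "`i†`" to be `j ∈ S±_{j+1}`; · "`λ`" to be … "ord(−)" of the element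
`q_{v_j}^{j²}` … the inclusion "`φ(p^λ·(R_I)^∼) ⊆ p^{⌊λ−d_I−a_I⌋}·log_p(R_I^×)`" of Proposition 1.4, (iii), implies
that [a multiple of `log_p(R_I^×)`] contains the "union of possible images of a Θ-pilot object" … (Ind1) and
(Ind2) are taken into account by the arbitrary nature of the automorphism "`φ`" … an upper bound on the
component of the log-volume of the holomorphic hull … may be obtained by computing an upper bound for the
log-volume of … "`p^{⌊λ−d_I−a_I⌋−b_I}·(R_I)^∼`""; p. 28 l. 30–64: ""`λ`" is asymmetric with respect to the
choice of "`i† ∈ I`" … after symmetrizing with respect to the choice of "`i† ∈ I`" …"; Step (vi), p. 29: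
"the inclusion "`φ((R_I)^∼) ⊆ (R_I)^∼`" of Proposition 1.4, (iv), implies that … the "container of possible
images" is precisely equal to [`(R_I)^∼`]". Dupuy–Hilado, arXiv:2004.13228, §4.7 ((Ind1) permutes the tensor
SLOTS together with the summands), §4.11 (`U_Θ = Ind2(Ind1((O_𝕃(−P_Θ))^{Ind3}))`), §4.12 (hull).

THEOREMS ONLY (abc-iut cell, WAVE-3 discharge seat abc-iut-c312-d1; the real-packet twin of
`MultiradialRegionHullBound.lean` at the Dupuy–Hilado interface), over abc-iut-S1's `PacketAlgebra`/`Prop12ii`/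
`Prop12iv` (HYPOTHESES here; `prop12ii_of_prop11`, `prop12iv_of_prop11`, `prop11_holds` discharge them),
abc-iut-S2's `packetHull`/`autImages`, abc-iut-S8's `packetLogVolume`. Once (Ind1) ranges over ALL permutations of
the `j+1` capsule indices (HOME/plan/c312/STEPV-IND1-NOTE.md, ruling R2), the `v⃗`-component of `U_Θ` receives
the theta value of EVERY slot `i ∈ I`: a union over `i ∈ I` (not only `i† = j`) of possible images of regions
`ι_i(g_i)·(R_I)^∼`, `‖g_i‖ = p^{−λ_i}`, `λ_i = m_i/e_i`. For such SLOT DATA and a slot `i₀` of LEAST order `λ_min`: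
the slot-union of possible images, its hull, and the hull of ANY region inside it lie in the ONE translate
`(p^{⌊λ_min−d_I−a_I⌋}·⊗h_i)·(R_I)^∼`; hence `μ^log ≤ {−λ_min + d_I + 1}·log(p) + Σ_{i∈I*}{3 + log(e_i)}` for
positive-volume regions in that hull, and the DISCREPANCY against the bare region of any reference slot `i₁`
(Dupuy–Hilado's last slot) is `≤ {λ_{i₁} − λ_min + d_I + 1}·log(p) + Σ_{i∈I*}{3 + log(e_i)}` — the per-summand
`δ(p,j,v⃗)` asked for by `DHData.estimateDH_of_componentBounds` (abc-iut-S2) in the `λ_min` form of abc-iut-S3's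
`Theorem110MinVariant`; Step (vi): slot UNITS do not move `(R_I)^∼` and under `Prop12iv` the hull stays in
`(R_I)^∼` (`μ^log ≤ 0`); admissibility (`0 < μ < ∞`) of these hulls ("`−|log(Θ)| ∈ ℝ`", summand by summand).
[cite: Mochizuki2012, IUTchIV Thm 1.10 proof Step (v) p.27–28, Step (vi) p.29] [cite: DupuyHilado2025, §4.7, §4.11, §4.12]
HONEST SCOPE: nothing here says that the Θ-pilot's possible images ARE of this form (the content of the
disputed [IUTchIII] Thm. 3.11 / Cor. 3.12 and of the model files); no side is taken; typed ≠ endorsed.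
-/

noncomputable section

open Set MeasureTheory
open scoped Pointwise TensorProduct

namespace Literature.IUT.LogVolume

variable (p : ℕ) [Fact p.Prime]
variable {I : Type} [Fintype I] [DecidableEq I]
variable (k : I → Type) [∀ i, NontriviallyNormedField (k i)] [∀ i, NormedAlgebra ℚ_[p] (k i)]
  [∀ i, IsUltrametricDist (k i)] [∀ i, ProperSpace (k i)]

/-! ## Elementary facts: `|I| ≥ 2`, slot orders, translates, slot units -/

omit [DecidableEq I] [∀ i, NontriviallyNormedField (k i)] [∀ i, NormedAlgebra ℚ_[p] (k i)]
  [∀ i, IsUltrametricDist (k i)] [∀ i, ProperSpace (k i)] in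
/-- `|I| ≥ 2 ⇒ I ≠ ∅`. [folklore] -/
private theorem nonempty_of_two_le_card (hI : 2 ≤ Fintype.card I) : Nonempty I :=
  Fintype.card_pos_iff.mp (by omega)

omit [Fintype I] [DecidableEq I] in
/-- A slot value `g` with `‖g‖ = p^{−m/e}` is nonzero and has `log ‖g‖ = −(m/e)·log(p)`.
[cite: Mochizuki2012, IUTchIV Thm 1.10 proof Step (v) p.27] -/
theorem slot_ne_zero_and_log_norm {i : I} {m : ℤ} {g : k i}
    (hg : ‖g‖ = (p : ℝ) ^ (-((m : ℝ) / absRamificationIdx p (k i)))) :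
    g ≠ 0 ∧ Real.log ‖g‖ = -((m : ℝ) / absRamificationIdx p (k i)) * Real.log p := by
  have hp0 : (0 : ℝ) < p := by exact_mod_cast (Fact.out : p.Prime).pos
  refine ⟨norm_pos_iff.mp (by rw [hg]; exact Real.rpow_pos_of_pos hp0 _), ?_⟩
  rw [hg, Real.log_rpow hp0]

omit [Fintype I] [DecidableEq I] [∀ i, NontriviallyNormedField (k i)] [∀ i, NormedAlgebra ℚ_[p] (k i)]
  [∀ i, IsUltrametricDist (k i)] [∀ i, ProperSpace (k i)] in
/-- The Step (v) exponent `⌊λ − d⌋` is monotone in `λ`. [cite: Mochizuki2012, IUTchIV Thm 1.10 proof Step (v) p.27] -/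
theorem floor_slot_mono {a b d : ℝ} (h : a ≤ b) : ⌊a - d⌋ ≤ ⌊b - d⌋ := Int.floor_le_floor (sub_le_sub_right h d)

/-- **The translates `(p^{n}·⊗h_i)·(R_I)^∼` decrease in `n`**: `n ≤ n' ⇒ (p^{n'}·⊗h_i)·(R_I)^∼ ⊆
(p^{n}·⊗h_i)·(R_I)^∼` (`p^{n'−n} ∈ R_I ⊆ (R_I)^∼`). [cite: Mochizuki2012, IUTchIV Prop. 1.1 p. 9] -/
theorem translate_subset_translate_of_le [Nonempty I] {n n' : ℤ} (hn : n ≤ n') (h : Π i, k i)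
    (hh : ∀ i, h i ≠ 0) :
    (ppow p k n' * purePacket p k h) • (normalizedPacket p k : Set (PacketAlgebra p k)) ⊆
      (ppow p k n * purePacket p k h) • (normalizedPacket p k : Set (PacketAlgebra p k)) := by
  refine smul_normalizedPacket_subset_of_prod_norm_le p k hh hh ?_
  have hp1 : (1 : ℝ) ≤ p := by exact_mod_cast (Fact.out : p.Prime).one_lt.le
  exact mul_le_mul_of_nonneg_right
    (Real.rpow_le_rpow_of_exponent_le hp1 (by exact_mod_cast neg_le_neg hn))
    (Finset.prod_nonneg fun i _ => norm_nonneg _)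

omit [Fintype I] [∀ i, IsUltrametricDist (k i)] [∀ i, ProperSpace (k i)] in
/-- A slot unit lies in `R_I`. [cite: Mochizuki2012, IUTchIV Prop. 1.1 p. 9] -/
theorem iota_mem_integerPacket_of_norm_le_one (i : I) {u : k i} (hu : ‖u‖ ≤ 1) :
    iota p k i u ∈ integerPacket p k := by
  rw [iota_eq_purePacket]
  refine purePacket_mem_integerPacket p k fun i' => ?_
  by_cases hi : i' = i
  · subst hi; rwa [Pi.mulSingle_eq_same]
  · rw [Pi.mulSingle_eq_of_ne hi, norm_one]

omit [Fintype I] [∀ i, IsUltrametricDist (k i)] [∀ i, ProperSpace (k i)] in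
/-- **A slot UNIT does not move the integral structure**: `‖u‖ = 1 ⇒ ι_i(u)·(R_I)^∼ = (R_I)^∼` (the bare region
at a place where the theta value is a unit: Step (v) "“`λ`” to be `0` if `v_j ∈ V^good`", Step (vi)).
[cite: Mochizuki2012, IUTchIV Thm 1.10 proof Step (v) p.27, Step (vi) p.29] -/
theorem iota_smul_normalizedPacket_eq_of_norm_eq_one (i : I) {u : k i} (hu : ‖u‖ = 1) :
    iota p k i u • (normalizedPacket p k : Set (PacketAlgebra p k)) = normalizedPacket p k := by
  have hu0 : u ≠ 0 := norm_pos_iff.mp (by rw [hu]; exact one_pos)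
  have hmem : iota p k i u ∈ normalizedPacket p k :=
    integerPacket_le_normalizedPacket p k (iota_mem_integerPacket_of_norm_le_one p k i hu.le)
  have hmem' : iota p k i u⁻¹ ∈ normalizedPacket p k :=
    integerPacket_le_normalizedPacket p k
      (iota_mem_integerPacket_of_norm_le_one p k i (by rw [norm_inv, hu, inv_one]))
  apply le_antisymm
  · rintro _ ⟨x, hx, rfl⟩
    exact mul_mem hmem hx
  · intro x hx
    refine ⟨iota p k i u⁻¹ * x, mul_mem hmem' hx, ?_⟩
    show iota p k i u • (iota p k i u⁻¹ * x) = x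
    rw [smul_eq_mul, ← mul_assoc, ← map_mul, mul_inv_cancel₀ hu0, map_one, one_mul]

/-! ## Steps (v)–(vi), slot-union form: the containers of the possible images of ALL slots and of their hulls -/

section Containers

variable {p k}

/-- **Every slot's possible images lie in a common container**: under `Prop12ii`, for slot data
`‖g_i‖ = p^{−m_i/e_i}` and any `n ≤ ⌊m_i/e_i − d_I − a_I⌋` (all `i`), the union over ALL slots of the possible
images of `ι_i(g_i)·(R_I)^∼` lies in `(p^{n}·⊗h_i)·(R_I)^∼`. [cite: Mochizuki2012, IUTchIV Thm 1.10 proof Step (v) p.27–28] -/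
theorem iUnion_autImages_slot_subset_translate_of_le (h12 : Prop12ii p k) (hI : 2 ≤ Fintype.card I)
    (m : I → ℤ) (g : Π i, k i)
    (hg : ∀ i, ‖g i‖ = (p : ℝ) ^ (-((m i : ℝ) / absRamificationIdx p (k i))))
    (h : Π i, k i) (hh : RealizesNegB p k h) {n : ℤ}
    (hn : ∀ i, n ≤ ⌊(m i : ℝ) / absRamificationIdx p (k i) - dSum p k - aSum p k⌋) :
    (⋃ i, autImages p k (iota p k i (g i) • (normalizedPacket p k : Set (PacketAlgebra p k)))) ⊆
      (ppow p k n * purePacket p k h) • (normalizedPacket p k : Set (PacketAlgebra p k)) := by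
  haveI : Nonempty I := nonempty_of_two_le_card hI
  have hh0 : ∀ i, h i ≠ 0 := fun i => (RealizesNegB.log_norm p k hh i).1
  refine Set.iUnion_subset fun i => ?_
  exact (autImages_smul_normalizedPacket_subset_translate p k h12 hI i (m i) (g i) (hg i) h hh).trans
    (translate_subset_translate_of_le p k (hn i) h hh0)

/-- **The slot-union container at `λ_min`, and its hull**: with `i₀` a slot of LEAST order, the holomorphic
hull of the union over all slots of the possible images lies in `(p^{⌊λ_min−d_I−a_I⌋}·⊗h_i)·(R_I)^∼` (translates
are hull-closed): "an upper bound on the component of the log-volume of the holomorphic hull … may be obtained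
by computing an upper bound for the log-volume of the right-hand side". [cite: Mochizuki2012, IUTchIV Thm 1.10 proof Step (v) p.28] -/
theorem packetHull_iUnion_autImages_slot_subset_translate (h12 : Prop12ii p k) (hI : 2 ≤ Fintype.card I)
    (m : I → ℤ) (g : Π i, k i)
    (hg : ∀ i, ‖g i‖ = (p : ℝ) ^ (-((m i : ℝ) / absRamificationIdx p (k i))))
    (h : Π i, k i) (hh : RealizesNegB p k h) (i₀ : I)
    (hmin : ∀ i, (m i₀ : ℝ) / absRamificationIdx p (k i₀) ≤ (m i : ℝ) / absRamificationIdx p (k i)) :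
    packetHull p k
        (⋃ i, autImages p k (iota p k i (g i) • (normalizedPacket p k : Set (PacketAlgebra p k)))) ⊆
      (ppow p k ⌊(m i₀ : ℝ) / absRamificationIdx p (k i₀) - dSum p k - aSum p k⌋ * purePacket p k h) •
        (normalizedPacket p k : Set (PacketAlgebra p k)) :=
  packetHull_subset_smul_normalizedPacket p k
    (iUnion_autImages_slot_subset_translate_of_le h12 hI m g hg h hh fun i => by
      simpa only [sub_sub] using floor_slot_mono (d := dSum p k + aSum p k) (hmin i))

/-- The same for the hull of ANY region `U` inside the slot-union of possible images (e.g. the `v⃗`-component of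
`U_Θ = Ind2(Ind1((O_𝕃(−P_Θ))^{Ind3}))`, (Ind3) inside the possible images, (Ind2) ⊆ the `log_p(R_I^×)`-automorphisms).
[cite: DupuyHilado2025, §4.11, §4.12] -/
theorem packetHull_subset_translate_of_subset_iUnion_autImages_slot (h12 : Prop12ii p k)
    (hI : 2 ≤ Fintype.card I) (m : I → ℤ) (g : Π i, k i)
    (hg : ∀ i, ‖g i‖ = (p : ℝ) ^ (-((m i : ℝ) / absRamificationIdx p (k i))))
    (h : Π i, k i) (hh : RealizesNegB p k h) (i₀ : I)
    (hmin : ∀ i, (m i₀ : ℝ) / absRamificationIdx p (k i₀) ≤ (m i : ℝ) / absRamificationIdx p (k i))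
    {U : Set (PacketAlgebra p k)}
    (hU : U ⊆ ⋃ i, autImages p k (iota p k i (g i) • (normalizedPacket p k : Set (PacketAlgebra p k)))) :
    packetHull p k U ⊆
      (ppow p k ⌊(m i₀ : ℝ) / absRamificationIdx p (k i₀) - dSum p k - aSum p k⌋ * purePacket p k h) •
        (normalizedPacket p k : Set (PacketAlgebra p k)) :=
  (packetHull_mono p k hU).trans (packetHull_iUnion_autImages_slot_subset_translate h12 hI m g hg h hh i₀ hmin)

omit [Fintype I] [∀ i, IsUltrametricDist (k i)] [∀ i, ProperSpace (k i)] in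
/-- Bookkeeping for the model files: a union, over a FAMILY of `log_p(R_I^×)`-automorphisms `φ` and the slots
`i`, of images `φ(B_i)` of sub-regions `B_i ⊆ ι_i(g_i)·(R_I)^∼` ((Ind2)-elements applied to (Ind1)-transports of
(Ind3)-data) lies in the slot-union of possible images. [cite: DupuyHilado2025, §4.11] -/
theorem biUnion_image_subset_iUnion_autImages_slot (g : Π i, k i)
    (B : I → Set (PacketAlgebra p k))
    (hB : ∀ i, B i ⊆ iota p k i (g i) • (normalizedPacket p k : Set (PacketAlgebra p k)))
    (Φ : Set (PacketAlgebra p k ≃ₗ[ℚ_[p]] PacketAlgebra p k)) (hΦ : ∀ φ ∈ Φ, IsLogPacketAut p k φ) :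
    (⋃ φ ∈ Φ, ⋃ i, (φ : PacketAlgebra p k → PacketAlgebra p k) '' B i) ⊆
      ⋃ i, autImages p k (iota p k i (g i) • (normalizedPacket p k : Set (PacketAlgebra p k))) := by
  refine Set.iUnion₂_subset fun φ hφ => Set.iUnion_subset fun i => ?_
  exact (Set.image_mono (hB i)).trans
    ((image_subset_autImages p k (hΦ φ hφ)).trans
      (Set.subset_iUnion
        (fun i' => autImages p k (iota p k i' (g i') • (normalizedPacket p k : Set (PacketAlgebra p k)))) i))

omit [DecidableEq I] in
/-- **Step (vi), slot-union form, the container**: under [IUTchIV] Prop. 1.2 (iv) (`Prop12iv`, hypothesis: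
`p > 2`, all `e_i = 1`, `|I| ≥ 2`), the hull of the slot-union of the possible images of ANY regions
`B_i ⊆ (R_I)^∼` (e.g. `ι_i(u_i)·(R_I)^∼` for slot units `u_i`, with (Ind3)-enlargements inside `(R_I)^∼`) lies
in `(R_I)^∼` — "the “container of possible images” is precisely equal to" it.
[cite: Mochizuki2012, IUTchIV Thm 1.10 proof Step (vi) p.29] -/
theorem packetHull_iUnion_autImages_subset_normalizedPacket (h4 : Prop12iv p k)
    (hI : 2 ≤ Fintype.card I) (hp : 2 < p) (he : ∀ i, absRamificationIdx p (k i) = 1)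
    {ι : Sort*} (B : ι → Set (PacketAlgebra p k))
    (hB : ∀ i, B i ⊆ (normalizedPacket p k : Set (PacketAlgebra p k))) :
    packetHull p k (⋃ i, autImages p k (B i)) ⊆ normalizedPacket p k := by
  refine packetHull_subset_normalizedPacket_of_subset_autImages p k h4 hI hp he ?_
  refine Set.iUnion_subset fun i => ?_
  intro x hx
  obtain ⟨φ, hφ, y, hy, rfl⟩ := (mem_autImages_iff p k).mp hx
  exact (mem_autImages_iff p k).mpr ⟨φ, hφ, y, hB i hy, rfl⟩

end Containers

/-! ## Steps (v)–(vi), slot-union form: log-volumes and admissibility along a decomposition `ψ` -/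

section Volume

variable {J : Type} [Fintype J] (L : J → Type) [∀ j, NontriviallyNormedField (L j)]
  [∀ j, NormedAlgebra ℚ_[p] (L j)] [∀ j, IsUltrametricDist (L j)] [∀ j, ProperSpace (L j)]
  [∀ j, MeasurableSpace (L j)] [∀ j, BorelSpace (L j)]
variable (ψ : PacketAlgebra p k ≃ₐ[ℚ_[p]] (Π j, L j))

omit [DecidableEq I] [∀ i, IsUltrametricDist (k i)] [∀ i, ProperSpace (k i)] in
/-- `V = ⊗_{ℚ_p} k_i ≠ 0` (a tensor basis vector is nonzero). [folklore] -/
private theorem nontrivial_packetAlgebra_aux : Nontrivial (PacketAlgebra p k) := by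
  let b : ∀ i, Module.Basis (Module.Free.ChooseBasisIndex ℚ_[p] (k i)) ℚ_[p] (k i) :=
    fun i ↦ Module.Free.chooseBasis ℚ_[p] (k i)
  let B := Basis.piTensorProduct b
  haveI : ∀ i, Nonempty (Module.Free.ChooseBasisIndex ℚ_[p] (k i)) := fun i ↦ (b i).index_nonempty
  obtain ⟨q⟩ : Nonempty (∀ i, Module.Free.ChooseBasisIndex ℚ_[p] (k i)) := inferInstance
  exact ⟨⟨B q, 0, B.ne_zero q⟩⟩

omit [DecidableEq I] [∀ i, IsUltrametricDist (k i)] [∀ i, ProperSpace (k i)] [Fintype J]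
  [∀ j, IsUltrametricDist (L j)] [∀ j, ProperSpace (L j)] [∀ j, MeasurableSpace (L j)]
  [∀ j, BorelSpace (L j)] in
include ψ in
/-- A decomposition `V ≃ ∏_j L_j` has at least one factor (`V ≠ 0`). [folklore] -/
private theorem nonempty_index' : Nonempty J := by
  haveI := nontrivial_packetAlgebra_aux p k
  by_contra hJ
  rw [not_nonempty_iff] at hJ
  have h01 : (0 : PacketAlgebra p k) = 1 := ψ.injective (Subsingleton.elim _ _)
  exact zero_ne_one h01

/-- The bare region of a slot with `‖g_i‖ = p^{−m_i/e_i}` has `μ^log(ι_i(g_i)·(R_I)^∼) = −(m_i/e_i)·log(p)` (the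
"`−λ·log(p)`"-type term of Step (v) for that slot). [cite: Mochizuki2012, IUTchIV Thm 1.10 proof Step (v) p.27] -/
theorem packetLogVolume_slot (hI : 2 ≤ Fintype.card I) (i : I) {m : ℤ} {g : k i}
    (hg : ‖g‖ = (p : ℝ) ^ (-((m : ℝ) / absRamificationIdx p (k i)))) :
    packetLogVolume p k L ψ (iota p k i g • (normalizedPacket p k : Set (PacketAlgebra p k))) =
      -((m : ℝ) / absRamificationIdx p (k i)) * Real.log p := by
  haveI : Nonempty I := nonempty_of_two_le_card hI
  haveI : Nonempty J := nonempty_index' p k L ψ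
  obtain ⟨hg0, hlog⟩ := slot_ne_zero_and_log_norm p k hg
  rw [packetLogVolume_iota_smul_normalizedPacket p k L ψ i hg0, hlog]

/-- **Step (v), slot-union form, the bound**: under `Prop12ii`, every region `U` of positive volume inside the
hull of the slot-union of possible images satisfies `μ^log(U) ≤ {−λ_min + d_I + 1}·log(p) + Σ_{i∈I*}{3 + log(e_i)}`
for any `I* ⊆ I` off which `e_i ≤ p − 2` (Prop. 1.4 (iii)'s second bound at the least-order slot `i₀`, abc-iut-S8
`packetLogVolume_le_of_subset_translate`). [cite: Mochizuki2012, IUTchIV Thm 1.10 proof Step (v) p.28] -/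
theorem packetLogVolume_le_of_subset_hull_slotUnion (h12 : Prop12ii p k) (hI : 2 ≤ Fintype.card I)
    (Istar : Finset I) (htame : ∀ i, i ∉ Istar → absRamificationIdx p (k i) ≤ p - 2)
    (m : I → ℤ) (g : Π i, k i)
    (hg : ∀ i, ‖g i‖ = (p : ℝ) ^ (-((m i : ℝ) / absRamificationIdx p (k i))))
    (h : Π i, k i) (hh : RealizesNegB p k h) (i₀ : I)
    (hmin : ∀ i, (m i₀ : ℝ) / absRamificationIdx p (k i₀) ≤ (m i : ℝ) / absRamificationIdx p (k i))
    {U : Set (PacketAlgebra p k)}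
    (hU : U ⊆ packetHull p k
      (⋃ i, autImages p k (iota p k i (g i) • (normalizedPacket p k : Set (PacketAlgebra p k)))))
    (hUpos : 0 < (piUnitBallStructure L).haar (ψ '' U)) :
    packetLogVolume p k L ψ U
      ≤ (-((m i₀ : ℝ) / absRamificationIdx p (k i₀)) + dSum p k + 1) * Real.log p
          + ∑ i ∈ Istar, (3 + Real.log (absRamificationIdx p (k i))) :=
  packetLogVolume_le_of_subset_translate p k L ψ hI Istar htame i₀ (m i₀) h hh
    (hU.trans (packetHull_iUnion_autImages_slot_subset_translate h12 hI m g hg h hh i₀ hmin)) hUpos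

/-- **The per-summand discrepancy (the `δ` of the `λ_min` form)**: under `Prop12ii`, for every positive-volume
`U` inside the hull of the slot-union of possible images and every reference slot `i₁` (Dupuy–Hilado's last slot,
whose bare region `t_{j,v_j}·O_{v⃗}` is the component of `O_𝕃(−P_Θ)`): `μ^log(U) − μ^log(ι_{i₁}(g_{i₁})·(R_I)^∼) ≤
{λ_{i₁} − λ_min + d_I + 1}·log(p) + Σ_{i∈I*}{3 + log(e_i)}` — the `δ(p,j,v⃗)` of `DHData.estimateDH_of_componentBounds`;
for `λ_{i₁} = λ_min` (e.g. `F_mod = ℚ`, or `i₁ = i₀`) it is the text's `{d_I + 1}·log(p) + Σ_{i∈I*}{3 + log(e_i)}`.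
[cite: Mochizuki2012, IUTchIV Thm 1.10 proof Step (v) p.28] [cite: DupuyHilado2025, §3.9, §4.11] -/
theorem packetLogVolume_sub_slot_le (h12 : Prop12ii p k) (hI : 2 ≤ Fintype.card I)
    (Istar : Finset I) (htame : ∀ i, i ∉ Istar → absRamificationIdx p (k i) ≤ p - 2)
    (m : I → ℤ) (g : Π i, k i)
    (hg : ∀ i, ‖g i‖ = (p : ℝ) ^ (-((m i : ℝ) / absRamificationIdx p (k i))))
    (h : Π i, k i) (hh : RealizesNegB p k h) (i₀ : I)
    (hmin : ∀ i, (m i₀ : ℝ) / absRamificationIdx p (k i₀) ≤ (m i : ℝ) / absRamificationIdx p (k i))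
    (i₁ : I) {U : Set (PacketAlgebra p k)}
    (hU : U ⊆ packetHull p k
      (⋃ i, autImages p k (iota p k i (g i) • (normalizedPacket p k : Set (PacketAlgebra p k)))))
    (hUpos : 0 < (piUnitBallStructure L).haar (ψ '' U)) :
    packetLogVolume p k L ψ U
        - packetLogVolume p k L ψ (iota p k i₁ (g i₁) • (normalizedPacket p k : Set (PacketAlgebra p k)))
      ≤ ((m i₁ : ℝ) / absRamificationIdx p (k i₁) - (m i₀ : ℝ) / absRamificationIdx p (k i₀)
            + dSum p k + 1) * Real.log p
          + ∑ i ∈ Istar, (3 + Real.log (absRamificationIdx p (k i))) := by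
  have h1 := packetLogVolume_le_of_subset_hull_slotUnion p k L ψ h12 hI Istar htame m g hg h hh i₀ hmin
    hU hUpos
  rw [packetLogVolume_slot p k L ψ hI i₁ (hg i₁)]
  have : ((m i₁ : ℝ) / absRamificationIdx p (k i₁) - (m i₀ : ℝ) / absRamificationIdx p (k i₀)
        + dSum p k + 1) * Real.log p =
      (-((m i₀ : ℝ) / absRamificationIdx p (k i₀)) + dSum p k + 1) * Real.log p
        - -((m i₁ : ℝ) / absRamificationIdx p (k i₁)) * Real.log p := by ring
  rw [this]
  linarith

/-- **Step (vi), slot-union form, the bound**: under `Prop12iv`, every region of positive volume inside the hull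
of the slot-union of possible images of regions `B_i ⊆ (R_I)^∼` has `μ^log ≤ 0 = μ^log((R_I)^∼)` ("Such an upper
bound “`0`” is given in the final equality of Proposition 1.4, (iv)") — at such primes the per-summand
discrepancy against a unit slot is `≤ 0`. [cite: Mochizuki2012, IUTchIV Thm 1.10 proof Step (vi) p.29] -/
theorem packetLogVolume_nonpos_of_subset_hull_units (h4 : Prop12iv p k)
    (hI : 2 ≤ Fintype.card I) (hp : 2 < p) (he : ∀ i, absRamificationIdx p (k i) = 1)
    {ι : Sort*} (B : ι → Set (PacketAlgebra p k))
    (hB : ∀ i, B i ⊆ (normalizedPacket p k : Set (PacketAlgebra p k)))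
    {U : Set (PacketAlgebra p k)} (hU : U ⊆ packetHull p k (⋃ i, autImages p k (B i)))
    (hUpos : 0 < (piUnitBallStructure L).haar (ψ '' U)) :
    packetLogVolume p k L ψ U ≤ 0 := by
  haveI : Nonempty I := nonempty_of_two_le_card hI
  have hsub := hU.trans (packetHull_iUnion_autImages_subset_normalizedPacket h4 hI hp he B hB)
  have htop : (piUnitBallStructure L).haar
      (ψ '' (normalizedPacket p k : Set (PacketAlgebra p k))) < ⊤ := by
    rw [image_normalizedPacket p k L ψ, ← coe_piUnitBallStructure, (piUnitBallStructure L).haar_self]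
    exact ENNReal.one_lt_top
  exact (packetLogVolume_mono p k L ψ hUpos htop hsub).trans (prop14iv_volume p k L ψ hI).le

omit [∀ i, IsUltrametricDist (k i)] [Fintype J] [∀ j, IsUltrametricDist (L j)] [∀ j, ProperSpace (L j)]
  [∀ j, MeasurableSpace (L j)] [∀ j, BorelSpace (L j)] in
/-- The components of `ψ(p^{n}·⊗h_i)` are nonzero (`‖·‖ = p^{−n}·∏‖h_i‖`). [claim: Mochizuki2012, status: disputed] -/
theorem psi_translate_ne_zero (n : ℤ) (h : Π i, k i) (hh : ∀ i, h i ≠ 0) (j : J) :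
    ψ (ppow p k n * purePacket p k h) j ≠ 0 := by
  have hp0 : (0 : ℝ) < p := by exact_mod_cast (Fact.out : p.Prime).pos
  rw [← norm_pos_iff, map_mul, Pi.mul_apply, norm_mul, norm_psi_ppow_apply, psi_purePacket_apply,
    norm_prod]
  refine mul_pos (zpow_pos hp0 _) (Finset.prod_pos fun i _ ↦ ?_)
  rw [norm_factorEmb]
  exact norm_pos_iff.mpr (hh i)

/-- **Positive volume**: any region containing one slot's bare region `ι_i(a)·(R_I)^∼`, `a ≠ 0`. [cite: DupuyHilado2025, §4.12 p. 16] -/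
theorem haar_pos_of_slot_subset (hI : 2 ≤ Fintype.card I) (i : I) {a : k i} (ha : a ≠ 0)
    {U : Set (PacketAlgebra p k)}
    (hU : iota p k i a • (normalizedPacket p k : Set (PacketAlgebra p k)) ⊆ U) :
    0 < (piUnitBallStructure L).haar (ψ '' U) := by
  haveI : Nonempty I := nonempty_of_two_le_card hI
  exact (haar_image_smul_normalizedPacket_pos p k L ψ _ (psi_iota_apply_ne_zero p k L ψ i ha)).trans_le
    (measure_mono (Set.image_mono hU))

/-- **Finite volume**: any region inside a translate `(p^{n}·⊗h_i)·(R_I)^∼` has finite volume. [cite: DupuyHilado2025, §4.12 p. 16] -/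
theorem haar_lt_top_of_subset_translate (hI : 2 ≤ Fintype.card I) (n : ℤ) (h : Π i, k i)
    (hh : ∀ i, h i ≠ 0) {U : Set (PacketAlgebra p k)}
    (hU : U ⊆ (ppow p k n * purePacket p k h) • (normalizedPacket p k : Set (PacketAlgebra p k))) :
    (piUnitBallStructure L).haar (ψ '' U) < ⊤ := by
  haveI : Nonempty I := nonempty_of_two_le_card hI
  exact (measure_mono (Set.image_mono hU)).trans_lt
    (haar_image_smul_normalizedPacket_lt_top p k L ψ _ (psi_translate_ne_zero p k L ψ n h hh))

/-- **Admissibility** (`0 < μ < ∞`, "`−|log(Θ)| ∈ ℝ`" summand by summand): the hull of any region between one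
slot's bare region and the slot-union of possible images has positive finite volume. [cite: DupuyHilado2025, §4.12 p. 16] -/
theorem haar_packetHull_slotUnion_pos_lt_top (h12 : Prop12ii p k) (hI : 2 ≤ Fintype.card I)
    (m : I → ℤ) (g : Π i, k i)
    (hg : ∀ i, ‖g i‖ = (p : ℝ) ^ (-((m i : ℝ) / absRamificationIdx p (k i))))
    (h : Π i, k i) (hh : RealizesNegB p k h) (i₀ : I)
    (hmin : ∀ i, (m i₀ : ℝ) / absRamificationIdx p (k i₀) ≤ (m i : ℝ) / absRamificationIdx p (k i))
    (i₁ : I) {U : Set (PacketAlgebra p k)}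
    (hUl : iota p k i₁ (g i₁) • (normalizedPacket p k : Set (PacketAlgebra p k)) ⊆ U)
    (hUu : U ⊆ ⋃ i, autImages p k (iota p k i (g i) • (normalizedPacket p k : Set (PacketAlgebra p k)))) :
    0 < (piUnitBallStructure L).haar (ψ '' packetHull p k U) ∧
      (piUnitBallStructure L).haar (ψ '' packetHull p k U) < ⊤ := by
  have hh0 : ∀ i, h i ≠ 0 := fun i => (RealizesNegB.log_norm p k hh i).1
  refine ⟨haar_pos_of_slot_subset p k L ψ hI i₁ (slot_ne_zero_and_log_norm p k (hg i₁)).1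
      (hUl.trans (subset_packetHull p k U)), ?_⟩
  exact haar_lt_top_of_subset_translate p k L ψ hI _ h hh0
    (packetHull_subset_translate_of_subset_iUnion_autImages_slot h12 hI m g hg h hh i₀ hmin hUu)

end Volume

end Literature.IUT.LogVolume

end
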